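import Literature.NumberTheory.Automorphic.AutomorphicInductionUnitaryCharacterCubicArchimedean
import Literature.NumberTheory.Automorphic.AutomorphicInductionUnitaryCharacterCubicResolventTower
import Literature.NumberTheory.Automorphic.BaseChangeCyclicCuspidal
import Literature.NumberTheory.Automorphic.HenniartAutomorphicInductionProofs
import Literature.NumberTheory.Automorphic.LanglandsTunnellFrobenius
import Literature.NumberTheory.Automorphic.AutomorphicRepInfinitesimalCharacter
import HarnessLib

/-!
# Non-normal cubic automorphic induction with its archimedean components: assembly from the
# unramified clause and the cyclic archimedean theory (proofs)

Topic `NumberTheory/Automorphic`; namespace `Literature.NumberTheory.Automorphic`.  A proof file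
(theorems only: no definition, no named fact, no instance) attached to the named fact
`Literature.NumberTheory.Automorphic.automorphicInduction_unitaryCharacter_cubic_archimedean`
(`AutomorphicInductionUnitaryCharacterCubicArchimedean`: Jacquet–Piatetski-Shapiro–Shalika,
*Relèvement cubique non normal* (1981) with *Automorphic forms on GL(3) II* (1979), §§13–14, as
restated in Gelbart 1997, Thm. 5.3.1 with Remark 5.3.1 (e) and §7.2 — for `E/F` cubic, not
necessarily Galois, and `θ` a unitary Hecke character of `E`, the cuspidal `π(θ)` on `GL₃(𝔸_F)`
with the induced Satake parameters AND the induced archimedean parameter).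

## Main result

`automorphicInduction_unitaryCharacter_cubic_archimedean_of_cubic_of_cyclicArchimedean`: the fact
follows from
* its unramified clause, the sibling fact `automorphicInduction_unitaryCharacter_cubic` (the
  converse-theorem content: existence of the cuspidal `π` with
  `det(X - t_{π,v}) = ∏_{w ∣ v} (X^{f(w|v)} - θ(ϖ_w))` a.e.), and
* the CYCLIC archimedean theory already named in the tree: `baseChange_cyclic_cuspidal`
  (Arthur–Clozel, Ch. 3 Thm. 4.2 (a), datum model), `ArthurClozel1989_strongLifting_archimedean`
  (Thm. 5.1 with Ch. 1 §7), `Henniart2012_infinityType_of_automorphicInduction` (Henniart 2012,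
  Thm. 5), and the existence of infinity types of cuspidal data
  (`AutomorphicRepData.exists_hasInfinityType`, Clozel 1990 §3.3, the currency of Henniart's fact).

So the archimedean clause carries no analytic debt of its own: the printed proof obtains the
archimedean components from the construction `π(θ) = ⊗_v π(Ind θ)_v` of the converse theorem;
here they are READ OFF the unramified ones through the `S₃`-tower of the Galois closure.

## The argument (`E/F` not normal; `L` the Galois closure, `K` the quadratic resolvent)

With `Gal(L/F) ≅ S₃`, `L/K` cyclic cubic, `L/E` and `K/F` quadratic (constructed as in
`AutomorphicInductionUnitaryCharacterCubicResolventTower`: splitting field of the minimal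
polynomial of a primitive element, fixed field of a subgroup of order `3`):
1. `P := BC_{K/F}(π)` is CUSPIDAL (`baseChange_cyclic_cuspidal`; its hypothesis "`-t_{π,v} ≠ t_{π,v}`
   at an inert `v`" holds because at a place inert in `K` — infinitely many exist,
   `frequently_forall_inertiaDeg_eq_two`, Frobenius' theorem — `v = w₁ w₂` has splitting type
   `(1, 2)` in `E` and `t_{π,v} = {a, r, -r}`, `a = θ(ϖ_{w₁}) ≠ 0`, of trace `a`:
   `exists_inert_hasSatakeParamAt_map_ne_of_resolvent`).
2. `P` is automorphically induced from `θ_L = θ ∘ N_{L/E}` along `L/K` in the sense of Def. 6.1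
   a.e. (`eventually_hasSatakeParamAt_baseChange_of_resolvent`): at a place of `F` split in `K`
   this is `finprod_resolventSplit_eq` of the descent file; at an inert place it is the SQUARES
   identity `det(X - t_{π,v}²) = (X - a²)(X - c)² = ∏_{W ∣ V} (X - θ_L(ϖ_W))`
   (`satakePolynomial_map_sq_eq_finprod_resolventInert`: one place of `L` above `w₁`, inert in
   `L/E`, value `a²`; two above `w₂`, split, value `c`).  In THIS direction (from `π` up to `K`)
   the sign ambiguity that blocks the descent proof of the unramified clause (module docstring
   of `AutomorphicInductionUnitaryCharacterCubicResolventDescent`) does not arise.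
3. Archimedean parameters (all in the currency `AutomorphicRepData.HasArchParameter`, unique by
   Harish-Chandra): `χ_π` restricts to `P` along `K/F` (Thm. 5.1); `χ_θ` restricts to the
   realisation of `θ_L` along `L/E` (Thm. 5.1 in rank one, the weak lift being
   `isWeakBaseChangeLiftAE_glOne_of_hasSatakeParamAt_baseChange`); Henniart's theorem along
   `L/K` gives `χ_P(σ_K) = ∑_{σ_L ∣ σ_K} χ_{θ_L}(σ_L)`; and restriction to `E` is a bijection
   from the embeddings of `L` above `σ_K` onto the embeddings of `E` above `σ_K|_F`
   (`sum_filter_comp_algebraMap_diamond`, `ringHom_eq_of_comp_algebraMap_eq`: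
   `Gal(L/K) ∩ Gal(L/E) = 1`).  Hence `χ_π(σ) = ∑_{σ' ∣ σ} χ_θ(σ')`.
For `E/F` Galois (cyclic cubic) Henniart's theorem applies along `E/F` itself
(`hasArchParameter_sum_of_isGalois`).

Nothing here discharges a named fact (net debt unchanged); no statement of the tree is modified.

## References

* H. Jacquet, I. I. Piatetski-Shapiro, J. Shalika, *Relèvement cubique non normal*, C. R. Acad.
  Sci. Paris 292 (1981) 567–571 [JPSS1981Cubique]; *Automorphic forms on GL(3) II*, Ann. of
  Math. 109 (1979), §§13–14. [JacquetPiatetskishapiroShalika1979II]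
* S. Gelbart, *Three lectures on the modularity of `ρ̄_{E,3}` and the Langlands reciprocity
  conjecture* (1997), Thm. 5.3.1, Remark 5.3.1 (e), §7.2 p. 258. [Gelbart1997]
* J. Arthur, L. Clozel, *Simple algebras, base change, and the advanced theory of the trace
  formula*, Ann. of Math. Stud. 120 (1989), Ch. 1 §7, Ch. 3 §1 (1.1), Def. 1.1, Thm. 4.2 (a),
  Thm. 5.1, Def. 6.1. [ArthurClozelAMS120]
* G. Henniart, *Induction automorphe globale pour les corps de nombres*, Bull. SMF 140 (2012),
  §1.10, Thm. 3, Thm. 5, Remarque finale §3.7. [Henniart2012]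
* L. Clozel, *Motifs et formes automorphes* (1990), §3.3. [Clozel1990]
-/

noncomputable section

open scoped NumberField Polynomial Classical
open NumberField IsDedekindDomain Polynomial Filter Literature.NumberTheory.Automorphic

namespace Literature.NumberTheory.Automorphic

/-! ### Embeddings of the sextic diagram `F ⊆ K ⊆ L ⊇ E ⊇ F` -/

section Embeddings

variable {F K L E : Type} [Field F] [Field K] [Field L] [Field E]
  [Algebra F K] [Algebra K L] [Algebra F L] [IsScalarTower F K L]
  [Algebra F E] [Algebra E L] [IsScalarTower F E L]

/-- **Embeddings in the sextic diagram are determined by their traces on `E` and `K`.**  In the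
diagram `F ⊆ K ⊆ L ⊇ E ⊇ F` with `L/F` Galois, `[L:K] = 3`, `[L:E] = 2`, two embeddings
`L →+* ℂ` with the same restrictions to `K` and to `E` coincide: they differ by an element of
`Gal(L/F)` (normality of `L/F`, `AlgHom.restrictNormal'`), which then fixes `K` and `E`
pointwise, hence is trivial (`Gal(L/K) ∩ Gal(L/E) = 1`, `algEquiv_eq_one_of_restrictScalars_eq`).
[folklore] -/
theorem ringHom_eq_of_comp_algebraMap_eq [FiniteDimensional K L] [FiniteDimensional E L]
    [IsGalois F L] [IsGalois K L] [IsGalois E L]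
    (hKL : Module.finrank K L = 3) (hEL : Module.finrank E L = 2) {σ₁ σ₂ : L →+* ℂ}
    (hK : σ₁.comp (algebraMap K L) = σ₂.comp (algebraMap K L))
    (hE : σ₁.comp (algebraMap E L) = σ₂.comp (algebraMap E L)) : σ₁ = σ₂ := by
  letI : Algebra F ℂ := (σ₁.comp (algebraMap F L)).toAlgebra
  letI : Algebra L ℂ := σ₁.toAlgebra
  haveI : IsScalarTower F L ℂ := IsScalarTower.of_algebraMap_eq fun _ => rfl
  have hF : σ₂.comp (algebraMap F L) = σ₁.comp (algebraMap F L) := by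
    rw [IsScalarTower.algebraMap_eq F K L, ← RingHom.comp_assoc, ← hK, RingHom.comp_assoc]
  let φ : L →ₐ[F] ℂ := { σ₂ with commutes' := fun x => RingHom.congr_fun hF x }
  set g : L ≃ₐ[F] L := φ.restrictNormal' L with hg
  have hgx : ∀ x : L, σ₁ (g x) = σ₂ x := fun x => AlgHom.restrictNormal_commutes φ L x
  -- `g` fixes `K` and `E` pointwise
  have hinj : Function.Injective σ₁ := σ₁.injective
  have hgK : ∀ k : K, g (algebraMap K L k) = algebraMap K L k := fun k =>
    hinj ((hgx _).trans (RingHom.congr_fun hK k).symm)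
  have hgE : ∀ e : E, g (algebraMap E L e) = algebraMap E L e := fun e =>
    hinj ((hgx _).trans (RingHom.congr_fun hE e).symm)
  let a : L ≃ₐ[K] L := { g with commutes' := hgK }
  let s : L ≃ₐ[E] L := { g with commutes' := hgE }
  have has : a.restrictScalars F = s.restrictScalars F := AlgEquiv.ext fun _ => rfl
  obtain ⟨-, ha⟩ := algEquiv_eq_one_of_restrictScalars_eq (F := F) hKL hEL has
  have hg1 : ∀ x, g x = x := fun x => congrArg (fun b : L ≃ₐ[K] L => b x) ha
  exact RingHom.ext fun x => by rw [← hgx x, hg1]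

/-- **Reindexing along the diamond**: for `σ_K : K →+* ℂ`, restriction to `E` is a bijection from
the embeddings `L →+* ℂ` above `σ_K` onto the embeddings `E →+* ℂ` above `σ_K|_F` (`L/F` Galois,
`[L:K] = [E:F] = 3`, `[L:E] = 2`: injective by `ringHom_eq_of_comp_algebraMap_eq`, and both sets
have `3` elements), so that sums over the former of a function of the trace on `E` are sums over
the latter. [folklore] -/
theorem sum_filter_comp_algebraMap_diamond [NumberField F] [NumberField K] [NumberField L]
    [NumberField E] [IsGalois F L] (hKL : Module.finrank K L = 3) (hEL : Module.finrank E L = 2)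
    (h3 : Module.finrank F E = 3) {M : Type*} [AddCommMonoid M] (χ : (E →+* ℂ) → M)
    (σK : K →+* ℂ) :
    ∑ σL ∈ Finset.univ.filter (fun σL : L →+* ℂ => σL.comp (algebraMap K L) = σK),
        χ (σL.comp (algebraMap E L)) =
      ∑ σ' ∈ Finset.univ.filter
          (fun σ' : E →+* ℂ => σ'.comp (algebraMap F E) = σK.comp (algebraMap F K)), χ σ' := by
  haveI : IsGalois K L := IsGalois.tower_top_of_isGalois F K L
  haveI : IsGalois E L := IsGalois.tower_top_of_isGalois F E L
  haveI : FiniteDimensional K L := Module.Finite.of_restrictScalars_finite ℚ K L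
  haveI : FiniteDimensional E L := Module.Finite.of_restrictScalars_finite ℚ E L
  have hmaps : ∀ σL ∈ Finset.univ.filter (fun σL : L →+* ℂ => σL.comp (algebraMap K L) = σK),
      σL.comp (algebraMap E L) ∈ Finset.univ.filter
        (fun σ' : E →+* ℂ => σ'.comp (algebraMap F E) = σK.comp (algebraMap F K)) := by
    intro σL hσL
    rw [Finset.mem_filter] at hσL ⊢
    refine ⟨Finset.mem_univ _, ?_⟩
    rw [RingHom.comp_assoc, ← IsScalarTower.algebraMap_eq F E L, IsScalarTower.algebraMap_eq F K L,
      ← RingHom.comp_assoc, hσL.2]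
  have hinj : Set.InjOn (fun σL : L →+* ℂ => σL.comp (algebraMap E L))
      ↑(Finset.univ.filter (fun σL : L →+* ℂ => σL.comp (algebraMap K L) = σK)) := by
    intro σ₁ h₁ σ₂ h₂ h12
    rw [Finset.coe_filter, Set.mem_setOf_eq] at h₁ h₂
    exact ringHom_eq_of_comp_algebraMap_eq (F := F) hKL hEL (h₁.2.trans h₂.2.symm) h12
  refine Finset.sum_nbij (fun σL : L →+* ℂ => σL.comp (algebraMap E L)) hmaps hinj ?_ fun _ _ => rfl
  -- surjectivity by counting: both sides have `3` elements
  have hcard : (Finset.univ.filter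
      (fun σ' : E →+* ℂ => σ'.comp (algebraMap F E) = σK.comp (algebraMap F K))).card ≤
      (Finset.univ.filter (fun σL : L →+* ℂ => σL.comp (algebraMap K L) = σK)).card := by
    rw [card_filter_comp_algebraMap_eq', card_filter_comp_algebraMap_eq', hKL, h3]
  intro σ' hσ'
  obtain ⟨σL, hσL, h⟩ := Finset.surj_on_of_inj_on_of_card_le (fun σL _ => σL.comp (algebraMap E L))
    hmaps (fun a₁ a₂ h₁ h₂ h => hinj h₁ h₂ h) hcard σ' hσ'
  exact ⟨σL, hσL, h.symm⟩

end Embeddings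



/-! ### Polynomial bookkeeping -/

section Poly

/-- `X² - c = (X - r)(X + r)` for `r² = c`. [folklore] -/
theorem X_sq_sub_C_eq_of_sq_eq {r c : ℂ} (h : r ^ 2 = c) :
    (X ^ 2 - C c : ℂ[X]) = (X - C r) * (X - C (-r)) := by
  rw [← h, map_neg, map_pow]
  ring

/-- The roots of `X² - c` are `{r, -r}` for `r² = c`. [folklore] -/
theorem roots_X_sq_sub_C_of_sq_eq {r c : ℂ} (h : r ^ 2 = c) :
    (X ^ 2 - C c : ℂ[X]).roots = {r, -r} := by
  rw [X_sq_sub_C_eq_of_sq_eq h, roots_mul ((monic_X_sub_C r).mul (monic_X_sub_C (-r))).ne_zero,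
    roots_X_sub_C, roots_X_sub_C]
  rfl

/-- A multiset with `∏_{x ∈ α} (X - x) = (X - a)(X² - c)` is `{a, r, -r}` with `r² = c`.
[folklore] -/
theorem exists_eq_triple_of_satakePolynomial_eq {α : Multiset ℂ} {a c : ℂ}
    (h : satakePolynomial α = (X - C a) * (X ^ 2 - C c)) :
    ∃ r : ℂ, r ^ 2 = c ∧ α = {a, r, -r} := by
  obtain ⟨r, hr⟩ := IsAlgClosed.exists_pow_nat_eq c two_pos
  refine ⟨r, hr, ?_⟩
  rw [← roots_satakePolynomial α, h,
    roots_mul ((monic_X_sub_C a).mul (monic_X_pow_sub_C c two_ne_zero)).ne_zero, roots_X_sub_C,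
    roots_X_sq_sub_C_of_sq_eq hr]
  rfl

/-- `∏_{x ∈ {a, r, -r}} (X - x²) = (X - a²)(X - r²)²`. [folklore] -/
theorem satakePolynomial_map_sq_triple (a r : ℂ) :
    satakePolynomial (({a, r, -r} : Multiset ℂ).map (· ^ 2)) =
      (X - C (a ^ 2)) * ((X - C (r ^ 2)) * (X - C (r ^ 2))) := by
  simp only [satakePolynomial, Multiset.insert_eq_cons, Multiset.map_cons, Multiset.map_singleton,
    Multiset.prod_cons, Multiset.prod_singleton, neg_sq]

/-- The trace of `{a, r, -r}` is `a`. [folklore] -/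
theorem Multiset.sum_triple_neg_cancel (a r : ℂ) : (({a, r, -r} : Multiset ℂ)).sum = a := by
  simp only [Multiset.insert_eq_cons, Multiset.sum_cons, Multiset.sum_singleton]
  ring

end Poly

/-! ### Places of `F` inert in the quadratic resolvent -/

section InertPlaces

variable {F K L E : Type} [Field F] [NumberField F] [Field K] [NumberField K]
  [Field L] [NumberField L] [Field E] [NumberField E]
  [Algebra F K] [Algebra K L] [Algebra F L] [IsScalarTower F K L]
  [Algebra F E] [Algebra E L] [IsScalarTower F E L]

/-- **Above a place inert in the quadratic `K/F` there is a single place of `K`** (`K/F` Galois,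
`v` unramified in `K`: the decomposition group of a place `V ∣ v` of degree `2` is all of
`Gal(K/F)`, which is transitive on the places above `v`). [folklore] -/
theorem HeightOneSpectrum.eq_of_inertiaDeg_eq_two [IsGalois F K] (hFK : Module.finrank F K = 2)
    {v : HeightOneSpectrum (𝓞 F)} {V V' : HeightOneSpectrum (𝓞 K)}
    (hV : V.asIdeal.under (𝓞 F) = v.asIdeal) (hV' : V'.asIdeal.under (𝓞 F) = v.asIdeal)
    (hinert : V.asIdeal.inertiaDeg (𝓞 F) = 2) (hvK : Algebra.IsUnramifiedIn (𝓞 K) v.asIdeal) :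
    V' = V := by
  obtain ⟨σ, rfl⟩ := HeightOneSpectrum.exists_algEquiv_smul_eq (F := F) (w := V) (w' := V')
    (HeightOneSpectrum.ext (hV.trans hV'.symm))
  exact HeightOneSpectrum.smul_eq_self_of_card_stabilizer_eq
    (by rw [HeightOneSpectrum.card_stabilizer_eq_inertiaDeg hV hvK, hinert, hFK]) σ

/-- **A place inert in the quadratic resolvent has exactly two places of the cubic field above
it, of degrees `1` and `2`** (`S₃` sextic diagram: `Gal(L/F)` non-abelian of order `6`,
`[L:K] = 3`, `[L:E] = 2`, `[E:F] = 3`; `v` unramified in `L` and `E`, the places of `E` above `v`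
unramified in `L`): the splitting type `(1, 2)` of
`exists_inertiaDeg_eq_one_and_eq_two_of_resolventInert`, completed by `∑_{w ∣ v} f(w|v) = 3`
(`finsum_inertiaDeg_eq_finrank`). [folklore] -/
theorem setOf_under_eq_pair_of_resolventInert [IsGalois F L] [IsGalois F K]
    (hG : ∃ g h : L ≃ₐ[F] L, g * h ≠ h * g)
    (hFL : Module.finrank F L = 6) (hKL : Module.finrank K L = 3) (hEL : Module.finrank E L = 2)
    (h3 : Module.finrank F E = 3)
    {v : HeightOneSpectrum (𝓞 F)} {V : HeightOneSpectrum (𝓞 K)}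
    (hV : V.asIdeal.under (𝓞 F) = v.asIdeal) (hinert : V.asIdeal.inertiaDeg (𝓞 F) = 2)
    (hv : Algebra.IsUnramifiedIn (𝓞 L) v.asIdeal) (hvE : Algebra.IsUnramifiedIn (𝓞 E) v.asIdeal)
    (hEu : ∀ w : HeightOneSpectrum (𝓞 E), w.asIdeal.under (𝓞 F) = v.asIdeal →
      Algebra.IsUnramifiedIn (𝓞 L) w.asIdeal) :
    ∃ w₁ w₂ : HeightOneSpectrum (𝓞 E), w₁.asIdeal.under (𝓞 F) = v.asIdeal ∧
      w₂.asIdeal.under (𝓞 F) = v.asIdeal ∧ w₁.asIdeal.inertiaDeg (𝓞 F) = 1 ∧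
        w₂.asIdeal.inertiaDeg (𝓞 F) = 2 ∧ w₁ ≠ w₂ ∧
          {w : HeightOneSpectrum (𝓞 E) | w.asIdeal.under (𝓞 F) = v.asIdeal} = {w₁, w₂} := by
  obtain ⟨w₁, w₂, hw₁, hw₂, hf₁, hf₂⟩ :=
    exists_inertiaDeg_eq_one_and_eq_two_of_resolventInert hG hFL hKL hEL h3 hV hinert hv hvE hEu
  have hne : w₁ ≠ w₂ := by
    rintro rfl
    rw [hf₁] at hf₂
    exact absurd hf₂ (by norm_num)
  refine ⟨w₁, w₂, hw₁, hw₂, hf₁, hf₂, hne, ?_⟩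
  have hS := finite_setOf_asIdeal_under_eq (E := E) v
  have hsum := finsum_inertiaDeg_eq_finrank (E := E) v hvE
  rw [finsum_mem_eq_finite_toFinset_sum _ hS, h3] at hsum
  have hsub : ({w₁, w₂} : Finset (HeightOneSpectrum (𝓞 E))) ⊆ hS.toFinset :=
    Finset.insert_subset_iff.2 ⟨hS.mem_toFinset.2 hw₁, Finset.singleton_subset_iff.2
      (hS.mem_toFinset.2 hw₂)⟩
  have hSE : hS.toFinset = {w₁, w₂} := by
    have hsplit := Finset.sum_sdiff hsub
      (f := fun w : HeightOneSpectrum (𝓞 E) => w.asIdeal.inertiaDeg (𝓞 F))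
    rw [hsum, Finset.sum_pair hne, hf₁, hf₂] at hsplit
    have hzero : ∑ w ∈ hS.toFinset \ {w₁, w₂}, w.asIdeal.inertiaDeg (𝓞 F) = 0 := by omega
    rw [Finset.sum_eq_zero_iff] at hzero
    refine Finset.Subset.antisymm ?_ hsub
    intro w hw
    by_contra hwn
    haveI := w.isPrime
    exact (w.asIdeal.inertiaDeg_pos (𝓞 F)).ne' (hzero w (Finset.mem_sdiff.2 ⟨hw, hwn⟩))
  rw [← hS.coe_toFinset, hSE, Finset.coe_insert, Finset.coe_singleton]

/-- **The induced Satake datum at a place inert in the resolvent is `{a, r, -r}`**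
(`a = θ(ϖ_{w₁})`, `r² = θ(ϖ_{w₂})` for the places `w₁, w₂` of degrees `1, 2` of `E` above `v`):
`∏_{w ∣ v} (X^{f(w|v)} - θ(ϖ_w)) = (X - a)(X² - r²)`. [folklore] -/
theorem exists_eq_triple_of_resolventInert [IsGalois F L] [IsGalois F K]
    (hG : ∃ g h : L ≃ₐ[F] L, g * h ≠ h * g)
    (hFL : Module.finrank F L = 6) (hKL : Module.finrank K L = 3) (hEL : Module.finrank E L = 2)
    (h3 : Module.finrank F E = 3)
    {v : HeightOneSpectrum (𝓞 F)} {V : HeightOneSpectrum (𝓞 K)}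
    (hV : V.asIdeal.under (𝓞 F) = v.asIdeal) (hinert : V.asIdeal.inertiaDeg (𝓞 F) = 2)
    (hv : Algebra.IsUnramifiedIn (𝓞 L) v.asIdeal) (hvE : Algebra.IsUnramifiedIn (𝓞 E) v.asIdeal)
    (hEu : ∀ w : HeightOneSpectrum (𝓞 E), w.asIdeal.under (𝓞 F) = v.asIdeal →
      Algebra.IsUnramifiedIn (𝓞 L) w.asIdeal)
    (θ : GaloisRepresentations.HeckeCharacter E) {α : Multiset ℂ}
    (hα : satakePolynomial α =
      ∏ᶠ w ∈ {w : HeightOneSpectrum (𝓞 E) | w.under (𝓞 F) = v},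
        (X ^ w.asIdeal.inertiaDeg (𝓞 F) - C (θ.valueAtUniformizer w))) :
    ∃ (w₁ w₂ : HeightOneSpectrum (𝓞 E)) (r : ℂ), w₁.asIdeal.under (𝓞 F) = v.asIdeal ∧
      w₂.asIdeal.under (𝓞 F) = v.asIdeal ∧ w₁.asIdeal.inertiaDeg (𝓞 F) = 1 ∧
        w₂.asIdeal.inertiaDeg (𝓞 F) = 2 ∧ w₁ ≠ w₂ ∧
          {w : HeightOneSpectrum (𝓞 E) | w.asIdeal.under (𝓞 F) = v.asIdeal} = {w₁, w₂} ∧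
            r ^ 2 = θ.valueAtUniformizer w₂ ∧ α = {θ.valueAtUniformizer w₁, r, -r} := by
  obtain ⟨w₁, w₂, hw₁, hw₂, hf₁, hf₂, hne, hpair⟩ :=
    setOf_under_eq_pair_of_resolventInert hG hFL hKL hEL h3 hV hinert hv hvE hEu
  rw [HeightOneSpectrum.setOf_under_eq, hpair, finprod_mem_pair hne, hf₁, hf₂, pow_one] at hα
  obtain ⟨r, hr, hαeq⟩ := exists_eq_triple_of_satakePolynomial_eq hα
  exact ⟨w₁, w₂, r, hw₁, hw₂, hf₁, hf₂, hne, hpair, hr, hαeq⟩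

/-- **The squares identity at a place inert in the resolvent** (`S₃` sextic diagram:
`Gal(L/F)` non-abelian of order `6`, `K/F` quadratic, `[L:K] = 3`, `[L:E] = 2`, `[E:F] = 3`; `v`
a place of `F` inert in `K`, unramified in `L`, `E`, `K`, with the places of `E` above it and the
place `V` of `K` above it unramified in `L`).  If `det(X - α) = ∏_{w ∣ v} (X^{f(w|v)} - θ(ϖ_w))`
(the induced Satake polynomial of `θ` along `E/F` at `v`), then
`det(X - α²) = ∏_{W ∣ V} (X^{f(W|V)} - θ(ϖ_{W ∩ E})^{f(W|W ∩ E)})` (the induced Satake polynomial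
of `θ ∘ N_{L/E}` along `L/K` at `V`): `v = w₁ w₂` in `E` with `f = 1, 2`, so `α = {a, r, -r}` with
`a = θ(ϖ_{w₁})`, `r² = c = θ(ϖ_{w₂})` (`exists_eq_triple_of_resolventInert`); above `V` lie three
degree-`1` places of `L` (`∑_{W ∣ V} f(W|V) = 3`), one above `w₁` (inert in `L/E`, value `a²`)
and two above `w₂` (split, value `c`) (`inertiaDeg_of_resolventInert`), so both sides are
`(X - a²)(X - c)²`.  This is the unramified base-change relation `t_{BC(π),V} = t_{π,v}²` between
the induction of `θ` to `GL₃(𝔸_F)` and the induction of `θ ∘ N_{L/E}` to `GL₃(𝔸_K)` at the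
places inert in `K` — in this direction there is no sign to choose. [folklore] -/
theorem satakePolynomial_map_sq_eq_finprod_resolventInert [IsGalois F L] [IsGalois F K]
    (hG : ∃ g h : L ≃ₐ[F] L, g * h ≠ h * g)
    (hFL : Module.finrank F L = 6) (hFK : Module.finrank F K = 2)
    (hKL : Module.finrank K L = 3) (hEL : Module.finrank E L = 2) (h3 : Module.finrank F E = 3)
    {v : HeightOneSpectrum (𝓞 F)} {V : HeightOneSpectrum (𝓞 K)}
    (hV : V.asIdeal.under (𝓞 F) = v.asIdeal) (hinert : V.asIdeal.inertiaDeg (𝓞 F) = 2)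
    (hv : Algebra.IsUnramifiedIn (𝓞 L) v.asIdeal) (hvE : Algebra.IsUnramifiedIn (𝓞 E) v.asIdeal)
    (hvK : Algebra.IsUnramifiedIn (𝓞 K) v.asIdeal) (hVu : Algebra.IsUnramifiedIn (𝓞 L) V.asIdeal)
    (hEu : ∀ w : HeightOneSpectrum (𝓞 E), w.asIdeal.under (𝓞 F) = v.asIdeal →
      Algebra.IsUnramifiedIn (𝓞 L) w.asIdeal)
    (θ : GaloisRepresentations.HeckeCharacter E) {b : HeightOneSpectrum (𝓞 L) → ℂ}
    (hb : ∀ W : HeightOneSpectrum (𝓞 L), W.asIdeal.under (𝓞 K) = V.asIdeal →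
      b W = θ.valueAtUniformizer (W.under (𝓞 E)) ^ W.asIdeal.inertiaDeg (𝓞 E))
    {α : Multiset ℂ}
    (hα : satakePolynomial α =
      ∏ᶠ w ∈ {w : HeightOneSpectrum (𝓞 E) | w.under (𝓞 F) = v},
        (X ^ w.asIdeal.inertiaDeg (𝓞 F) - C (θ.valueAtUniformizer w))) :
    satakePolynomial (α.map (· ^ 2)) =
      ∏ᶠ W ∈ {W : HeightOneSpectrum (𝓞 L) | W.under (𝓞 K) = V},
        (X ^ W.asIdeal.inertiaDeg (𝓞 K) - C (b W)) := by
  haveI : IsGalois K L := IsGalois.tower_top_of_isGalois F K L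
  haveI : IsGalois E L := IsGalois.tower_top_of_isGalois F E L
  obtain ⟨w₁, w₂, r, hw₁, -, hf₁, hf₂, hne, hpair, hr, hαeq⟩ :=
    exists_eq_triple_of_resolventInert hG hFL hKL hEL h3 hV hinert hv hvE hEu θ hα
  set a : ℂ := θ.valueAtUniformizer w₁ with ha
  set c : ℂ := θ.valueAtUniformizer w₂ with hc
  have hSE' : ∀ w : HeightOneSpectrum (𝓞 E), w.asIdeal.under (𝓞 F) = v.asIdeal →
      w = w₁ ∨ w = w₂ := fun w hw => by
    have hmem : w ∈ ({w₁, w₂} : Set (HeightOneSpectrum (𝓞 E))) := hpair ▸ hw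
    simpa only [Set.mem_insert_iff, Set.mem_singleton_iff] using hmem
  have hLHS : satakePolynomial (α.map (· ^ 2)) = (X - C (a ^ 2)) * ((X - C c) * (X - C c)) := by
    rw [hαeq, satakePolynomial_map_sq_triple, hr]
  -- the places of `L` above `V`: degree `1` over `K`, above `w₁` (inert, value `a²`) or above
  -- `w₂` (split, value `c`)
  have hT := finite_setOf_asIdeal_under_eq (E := L) V
  have hTW : ∀ W ∈ hT.toFinset, W.asIdeal.inertiaDeg (𝓞 K) = 1 ∧
      (W.under (𝓞 E) = w₁ ∧ W.asIdeal.inertiaDeg (𝓞 E) = 2 ∧ b W = a ^ 2 ∨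
        W.under (𝓞 E) = w₂ ∧ W.asIdeal.inertiaDeg (𝓞 E) = 1 ∧ b W = c) := by
    intro W hWmem
    have hWV : W.asIdeal.under (𝓞 K) = V.asIdeal := hT.mem_toFinset.1 hWmem
    obtain ⟨hfK, -, hcase⟩ :=
      HeightOneSpectrum.inertiaDeg_of_resolventInert hG hFL hKL hEL hV hWV hinert hv
    have hWv : (W.under (𝓞 E)).asIdeal.under (𝓞 F) = v.asIdeal := by
      show (W.asIdeal.under (𝓞 E)).under (𝓞 F) = v.asIdeal
      rw [Ideal.under_under, ← Ideal.under_under (B := 𝓞 K) W.asIdeal, hWV, hV]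
    refine ⟨hfK, ?_⟩
    rcases hcase with ⟨hfE, hf2⟩ | ⟨hfE, hf1⟩
    · right
      rcases hSE' (W.under (𝓞 E)) hWv with h | h
      · exfalso
        have e : W.asIdeal.under (𝓞 E) = w₁.asIdeal := congrArg HeightOneSpectrum.asIdeal h
        rw [e, hf₁] at hf2
        exact absurd hf2 (by norm_num)
      · exact ⟨h, hfE, by rw [hb W hWV, hfE, pow_one, h]⟩
    · left
      rcases hSE' (W.under (𝓞 E)) hWv with h | h
      · exact ⟨h, hfE, by rw [hb W hWV, hfE, h]⟩
      · exfalso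
        have e : W.asIdeal.under (𝓞 E) = w₂.asIdeal := congrArg HeightOneSpectrum.asIdeal h
        rw [e, hf₂] at hf1
        exact absurd hf1 (by norm_num)
  -- there are `3` of them (`∑_{W ∣ V} f(W|V) = [L:K] = 3`), exactly one above `w₁`
  have hcardT : hT.toFinset.card = 3 := by
    have hsumL := finsum_inertiaDeg_eq_finrank (E := L) V hVu
    rw [finsum_mem_eq_finite_toFinset_sum _ hT, hKL] at hsumL
    rw [Finset.card_eq_sum_ones, ← hsumL]
    exact Finset.sum_congr rfl fun W hW => ((hTW W hW).1).symm
  have hT₁ : (hT.toFinset.filter fun W => W.under (𝓞 E) = w₁).card = 1 := by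
    obtain ⟨W₁, hW₁⟩ := exists_above (E := L) w₁
    have hW₁V : W₁.asIdeal.under (𝓞 K) = V.asIdeal := by
      have h1 : (W₁.under (𝓞 K)).asIdeal.under (𝓞 F) = v.asIdeal := by
        show (W₁.asIdeal.under (𝓞 K)).under (𝓞 F) = v.asIdeal
        rw [Ideal.under_under, ← Ideal.under_under (B := 𝓞 E) W₁.asIdeal, hW₁, hw₁]
      exact congrArg HeightOneSpectrum.asIdeal
        (HeightOneSpectrum.eq_of_inertiaDeg_eq_two hFK hV h1 hinert hvK)
    have hW₁mem : W₁ ∈ hT.toFinset := hT.mem_toFinset.2 hW₁V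
    have hfW₁ : W₁.asIdeal.inertiaDeg (𝓞 E) = 2 := by
      rcases (hTW W₁ hW₁mem).2 with ⟨-, h2, -⟩ | ⟨h, -, -⟩
      · exact h2
      · exfalso
        exact hne ((HeightOneSpectrum.ext hW₁ : W₁.under (𝓞 E) = w₁).symm.trans h)
    rw [Finset.card_eq_one]
    refine ⟨W₁, Finset.eq_singleton_iff_unique_mem.2 ⟨?_, ?_⟩⟩
    · exact Finset.mem_filter.2 ⟨hW₁mem, HeightOneSpectrum.ext hW₁⟩
    · intro W hW
      obtain ⟨-, hWE⟩ := Finset.mem_filter.1 hW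
      obtain ⟨s, rfl⟩ := HeightOneSpectrum.exists_algEquiv_smul_eq (F := E) (w := W₁) (w' := W)
        ((HeightOneSpectrum.ext hW₁ : W₁.under (𝓞 E) = w₁).trans hWE.symm)
      exact HeightOneSpectrum.smul_eq_self_of_card_stabilizer_eq
        (by rw [HeightOneSpectrum.card_stabilizer_eq_inertiaDeg hW₁ (hEu w₁ hw₁), hfW₁, hEL]) s
  have hT₂ : (hT.toFinset.filter fun W => ¬ W.under (𝓞 E) = w₁).card = 2 := by
    have := Finset.card_filter_add_card_filter_not (s := hT.toFinset)
      (p := fun W : HeightOneSpectrum (𝓞 L) => W.under (𝓞 E) = w₁)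
    omega
  have hRHS : ∏ᶠ W ∈ {W : HeightOneSpectrum (𝓞 L) | W.under (𝓞 K) = V},
      (X ^ W.asIdeal.inertiaDeg (𝓞 K) - C (b W)) = (X - C (a ^ 2)) ^ 1 * (X - C c) ^ 2 := by
    rw [HeightOneSpectrum.setOf_under_eq, finprod_mem_eq_finite_toFinset_prod _ hT,
      ← Finset.prod_filter_mul_prod_filter_not hT.toFinset
        (fun W : HeightOneSpectrum (𝓞 L) => W.under (𝓞 E) = w₁)]
    congr 1
    · rw [← hT₁, ← Finset.prod_const]
      refine Finset.prod_congr rfl fun W hW => ?_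
      obtain ⟨hWT, hWE⟩ := Finset.mem_filter.1 hW
      obtain ⟨hfK, hcase⟩ := hTW W hWT
      rcases hcase with ⟨-, -, hbW⟩ | ⟨h, -, -⟩
      · rw [hfK, pow_one, hbW]
      · exact absurd (hWE.symm.trans h) hne
    · rw [← hT₂, ← Finset.prod_const]
      refine Finset.prod_congr rfl fun W hW => ?_
      obtain ⟨hWT, hWE⟩ := Finset.mem_filter.1 hW
      obtain ⟨hfK, hcase⟩ := hTW W hWT
      rcases hcase with ⟨h, -, -⟩ | ⟨-, -, hbW⟩
      · exact absurd h hWE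
      · rw [hfK, pow_one, hbW]
  rw [hLHS, hRHS]
  ring

/-- **Infinitely many places of `F` are inert in the quadratic extension `K/F`** (Frobenius'
density theorem for the quadratic character of `K/F`, through the tree's
`infinite_setOf_frob_pow_and_quadraticSign_eq_neg_one` with the trivial Artin representation):
for infinitely many `v`, every place of `K` above `v` has residue degree `2`. [folklore] -/
theorem frequently_forall_inertiaDeg_eq_two (hFK : Module.finrank F K = 2) :
    ∃ᶠ v : HeightOneSpectrum (𝓞 F) in cofinite, ∀ V : HeightOneSpectrum (𝓞 K),
      V.asIdeal.under (𝓞 F) = v.asIdeal → V.asIdeal.inertiaDeg (𝓞 F) = 2 := by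
  haveI : FiniteDimensional F K := Module.finite_of_finrank_eq_succ hFK
  obtain ⟨-, hindex⟩ := isOpen_range_absGaloisRestrict_and_index F K
  have hg₀ : ∃ g₀ : Field.absoluteGaloisGroup F,
      g₀ ∉ ((GaloisRepresentations.absGaloisRestrict F K).range :
        Subgroup (Field.absoluteGaloisGroup F)) := by
    by_contra h
    push Not at h
    have htop : ((GaloisRepresentations.absGaloisRestrict F K).range :
        Subgroup (Field.absoluteGaloisGroup F)) = ⊤ := eq_top_iff.2 fun x _ => h x
    rw [htop, Subgroup.index_top, hFK] at hindex
    exact absurd hindex (by norm_num)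
  obtain ⟨g₀, hg₀⟩ := hg₀
  have hinf := infinite_setOf_frob_pow_and_quadraticSign_eq_neg_one K
    (1 : GaloisRepresentations.FramedArtinRep F 2) hFK hg₀
  rw [Set.infinite_iff_frequently_cofinite] at hinf
  refine hinf.mono fun v hv V hVv => ?_
  obtain ⟨-, hsign, -⟩ := hv
  rcases inertiaDeg_eq_one_or_two_of_finrank_eq_two hFK v V hVv with h1 | h2
  · exfalso
    unfold quadraticSign at hsign
    rw [if_pos ⟨V, hVv, h1⟩] at hsign
    norm_num at hsign
  · exact h2

/-- **The non-twist hypothesis of `baseChange_cyclic_cuspidal` for the induction of `θ` to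
`GL₃(𝔸_F)` along the quadratic resolvent** (`S₃` sextic diagram).  If `π` on `GL₃(𝔸_F)` has
`det(X - t_{π,v}) = ∏_{w ∣ v} (X^{f(w|v)} - θ(ϖ_w))` at almost every `v`, then at some place `v`
inert in `K` (infinitely many exist, `frequently_forall_inertiaDeg_eq_two`; almost all are
unramified in the diagram) `t_{π,v} = {a, r, -r}` with `a = θ(ϖ_{w₁}) ≠ 0`
(`exists_eq_triple_of_resolventInert`), so `tr t_{π,v} = a ≠ 0` and `-t_{π,v} ≠ t_{π,v}`
(`map_neg_ne_of_sum_ne_zero`): `π ≇ π ⊗ η_{K/F}`. [folklore] -/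
theorem exists_inert_hasSatakeParamAt_map_ne_of_resolvent [IsGalois F L] [IsGalois F K]
    (hG : ∃ g h : L ≃ₐ[F] L, g * h ≠ h * g)
    (hFL : Module.finrank F L = 6) (hFK : Module.finrank F K = 2)
    (hKL : Module.finrank K L = 3) (hEL : Module.finrank E L = 2) (h3 : Module.finrank F E = 3)
    (θ : GaloisRepresentations.HeckeCharacter E) {hF : isCompact_glFiniteIntegralLevel 3 F}
    (π : AutomorphicRepData (AutomorphyDatum.gl 3 F hF))
    (hπ : ∀ᶠ v : HeightOneSpectrum (𝓞 F) in cofinite, ∃ α : Multiset ℂ,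
      π.HasSatakeParamAt v α ∧
        satakePolynomial α =
          ∏ᶠ w ∈ {w : HeightOneSpectrum (𝓞 E) | w.under (𝓞 F) = v},
            (X ^ w.asIdeal.inertiaDeg (𝓞 F) - C (θ.valueAtUniformizer w))) :
    ∃ (v : HeightOneSpectrum (𝓞 F)) (V : HeightOneSpectrum (𝓞 K)) (α : Multiset ℂ),
      V.asIdeal.under (𝓞 F) = v.asIdeal ∧ V.asIdeal.inertiaDeg (𝓞 F) = Module.finrank F K ∧
        π.HasSatakeParamAt v α ∧
          ∀ ζ : ℂ, IsPrimitiveRoot ζ (Module.finrank F K) → α.map (ζ * ·) ≠ α := by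
  have hur : ∀ᶠ v : HeightOneSpectrum (𝓞 F) in cofinite,
      Algebra.IsUnramifiedIn (𝓞 L) v.asIdeal ∧ Algebra.IsUnramifiedIn (𝓞 E) v.asIdeal ∧
        ∀ w : HeightOneSpectrum (𝓞 E), w.asIdeal.under (𝓞 F) = v.asIdeal →
          Algebra.IsUnramifiedIn (𝓞 L) w.asIdeal :=
    (Filter.eventually_cofinite.2 (GaloisRepresentations.finite_setOf_not_isUnramifiedIn F L)).and
      ((Filter.eventually_cofinite.2 (GaloisRepresentations.finite_setOf_not_isUnramifiedIn F E)).and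
        (eventually_forall_under_eq (F := F) (Filter.eventually_cofinite.2
          (GaloisRepresentations.finite_setOf_not_isUnramifiedIn E L))))
  obtain ⟨v, hinert, ⟨α, hα, hαθ⟩, hvL, hvE, hEu⟩ :=
    ((frequently_forall_inertiaDeg_eq_two (F := F) (K := K) hFK).and_eventually (hπ.and hur)).exists
  obtain ⟨V, hV⟩ := exists_above (E := K) v
  have hV2 := hinert V hV
  obtain ⟨w₁, w₂, r, -, -, -, -, -, -, -, hαeq⟩ :=
    exists_eq_triple_of_resolventInert hG hFL hKL hEL h3 hV hV2 hvL hvE hEu θ hαθ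
  refine ⟨v, V, α, hV, hV2.trans hFK.symm, hα, fun ζ hζ => ?_⟩
  rw [hFK] at hζ
  refine map_neg_ne_of_sum_ne_zero ?_ hζ
  rw [hαeq, Multiset.sum_triple_neg_cancel]
  exact Units.ne_zero _

end InertPlaces


/-! ### Base change of the realisations of `θ` on `GL₁` -/

section GLOne

variable {E L : Type} [Field E] [NumberField E] [Field L] [NumberField L] [Algebra E L]

/-- **`π_{θ ∘ N_{L/E}}` is a weak base-change lift of `π_θ`** (rank one, `L/E` Galois): for
automorphic representation data `τ` of `GL₁(𝔸_E)` and `τ_L` of `GL₁(𝔸_L)` with the Satake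
parameters `{θ(ϖ_w)}`, `{(θ ∘ N_{L/E})(ϖ_W)}` of `θ` and of its base change almost everywhere,
`t_{τ_L,W} = t_{τ,w}^{f(W|w)}` at almost every `W ∣ w`, because
`(θ ∘ N_{L/E})(ϖ_W) = θ(ϖ_w)^{f(W|w)}` (`HeckeCharacter.eventually_valueAtUniformizer_baseChange`,
Arthur–Clozel's relation (1.1) in rank one) and Satake parameters are unique.
[cite: ArthurClozelAMS120, Ch. 3, §1 (1.1) and Def. 1.1] -/
theorem isWeakBaseChangeLiftAE_glOne_of_hasSatakeParamAt_baseChange [IsGalois E L]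
    {hE : isCompact_glFiniteIntegralLevel 1 E} {hL : isCompact_glFiniteIntegralLevel 1 L}
    (θ : GaloisRepresentations.HeckeCharacter E)
    {τ : AutomorphicRepData (AutomorphyDatum.gl 1 E hE)}
    {τL : AutomorphicRepData (AutomorphyDatum.gl 1 L hL)}
    (hτ : ∀ᶠ w : HeightOneSpectrum (𝓞 E) in cofinite, τ.HasSatakeParamAt w {θ.valueAtUniformizer w})
    (hτL : ∀ᶠ W : HeightOneSpectrum (𝓞 L) in cofinite,
      τL.HasSatakeParamAt W {(θ.baseChange L).valueAtUniformizer W}) :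
    IsWeakBaseChangeLiftAE τ τL := by
  filter_upwards [hτL, θ.eventually_valueAtUniformizer_baseChange (E := L),
    eventually_under (E := L) hτ] with W hW hθW hτw w α hWw hα
  obtain rfl : W.under (𝓞 E) = w := HeightOneSpectrum.ext hWw
  rw [τ.hasSatakeParamAt_unique_holds hα (hτw _ hWw), Multiset.map_singleton, ← hθW]
  exact hW

end GLOne

/-! ### The archimedean clause through the resolvent tower -/

section Resolvent

variable {F K L E : Type} [Field F] [NumberField F] [Field K] [NumberField K]
  [Field L] [NumberField L] [Field E] [NumberField E]
  [Algebra F K] [Algebra K L] [Algebra F L] [IsScalarTower F K L]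
  [Algebra F E] [Algebra E L] [IsScalarTower F E L]

/-- **The induced Satake data of `θ ∘ N_{L/E}` along `L/K` are the base change of the induced
Satake data of `θ` along `E/F`** (`S₃` sextic diagram; Mackey's formula
`Res_{W_K} Ind_{W_E}^{W_F} θ = Ind_{W_L}^{W_K} (θ ∘ N_{L/E})` at the unramified places).  If `π`
on `GL₃(𝔸_F)` has `det(X - t_{π,v}) = ∏_{w ∣ v} (X^{f(w|v)} - θ(ϖ_w))` almost everywhere and `P`
on `GL₃(𝔸_K)` is a weak base-change lift of `π` (`t_{P,V} = t_{π,v}^{f(V|v)}` a.e.), then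
`det(X - t_{P,V}) = ∏_{W ∣ V} (X^{f(W|V)} - (θ ∘ N_{L/E})(ϖ_W))` for almost all `V`: at a place
split in `K` this is `finprod_resolventSplit_eq`, at an inert place
`satakePolynomial_map_sq_eq_finprod_resolventInert`. [folklore] -/
theorem eventually_hasSatakeParamAt_baseChange_of_resolvent [IsGalois F L] [IsGalois F K]
    [IsGalois E L] (hG : ∃ g h : L ≃ₐ[F] L, g * h ≠ h * g)
    (hFK : Module.finrank F K = 2) (hKL : Module.finrank K L = 3) (hEL : Module.finrank E L = 2)
    (h3 : Module.finrank F E = 3) (θ : GaloisRepresentations.HeckeCharacter E)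
    {hF : isCompact_glFiniteIntegralLevel 3 F} {hK : isCompact_glFiniteIntegralLevel 3 K}
    {π : AutomorphicRepData (AutomorphyDatum.gl 3 F hF)}
    {P : AutomorphicRepData (AutomorphyDatum.gl 3 K hK)}
    (hπ : ∀ᶠ v : HeightOneSpectrum (𝓞 F) in cofinite, ∃ α : Multiset ℂ,
      π.HasSatakeParamAt v α ∧
        satakePolynomial α =
          ∏ᶠ w ∈ {w : HeightOneSpectrum (𝓞 E) | w.under (𝓞 F) = v},
            (X ^ w.asIdeal.inertiaDeg (𝓞 F) - C (θ.valueAtUniformizer w)))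
    (hBC : IsWeakBaseChangeLiftAE π P) :
    ∀ᶠ V : HeightOneSpectrum (𝓞 K) in cofinite, ∃ α : Multiset ℂ,
      P.HasSatakeParamAt V α ∧
        satakePolynomial α =
          ∏ᶠ W ∈ {W : HeightOneSpectrum (𝓞 L) | W.under (𝓞 K) = V},
            (X ^ W.asIdeal.inertiaDeg (𝓞 K) - C ((θ.baseChange L).valueAtUniformizer W)) := by
  haveI : IsGalois K L := IsGalois.tower_top_of_isGalois F K L
  haveI : FiniteDimensional F L := Module.Finite.of_restrictScalars_finite ℚ F L
  haveI : FiniteDimensional F K := Module.Finite.of_restrictScalars_finite ℚ F K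
  haveI : FiniteDimensional K L := Module.Finite.of_restrictScalars_finite ℚ K L
  have hFL : Module.finrank F L = 6 := by rw [← Module.finrank_mul_finrank F K L, hFK, hKL]
  have hθLW : ∀ᶠ W : HeightOneSpectrum (𝓞 L) in cofinite, (θ.baseChange L).valueAtUniformizer W =
      θ.valueAtUniformizer (W.under (𝓞 E)) ^ W.asIdeal.inertiaDeg (𝓞 E) :=
    θ.eventually_valueAtUniformizer_baseChange (E := L)
  have hurK : ∀ᶠ V : HeightOneSpectrum (𝓞 K) in cofinite,
      Algebra.IsUnramifiedIn (𝓞 L) V.asIdeal :=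
    Filter.eventually_cofinite.2 (GaloisRepresentations.finite_setOf_not_isUnramifiedIn K L)
  have hurF : ∀ᶠ v : HeightOneSpectrum (𝓞 F) in cofinite,
      Algebra.IsUnramifiedIn (𝓞 L) v.asIdeal ∧ Algebra.IsUnramifiedIn (𝓞 K) v.asIdeal ∧
        Algebra.IsUnramifiedIn (𝓞 E) v.asIdeal ∧
          ∀ w : HeightOneSpectrum (𝓞 E), w.asIdeal.under (𝓞 F) = v.asIdeal →
            Algebra.IsUnramifiedIn (𝓞 L) w.asIdeal :=
    (Filter.eventually_cofinite.2 (GaloisRepresentations.finite_setOf_not_isUnramifiedIn F L)).and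
      ((Filter.eventually_cofinite.2 (GaloisRepresentations.finite_setOf_not_isUnramifiedIn F K)).and
        ((Filter.eventually_cofinite.2
          (GaloisRepresentations.finite_setOf_not_isUnramifiedIn F E)).and
          (eventually_forall_under_eq (F := F) (Filter.eventually_cofinite.2
            (GaloisRepresentations.finite_setOf_not_isUnramifiedIn E L)))))
  have hgood := hπ.and (hurF.and (eventually_forall_under_eq (F := F)
    (hBC.and ((eventually_forall_under_eq (F := K) hθLW).and hurK))))
  filter_upwards [eventually_under (E := K) hgood] with V hV
  obtain ⟨⟨α, hα, hαθ⟩, ⟨hvL, hvK, hvE, hEu⟩, hKv⟩ := hV (V.under (𝓞 F)) rfl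
  obtain ⟨hBCV, hθV, hVu⟩ := hKv V rfl
  have hPα : P.HasSatakeParamAt V (α.map (· ^ V.asIdeal.inertiaDeg (𝓞 F))) := hBCV _ α rfl hα
  rcases inertiaDeg_eq_one_or_two_of_finrank_eq_two hFK (V.under (𝓞 F)) V rfl with h1 | h2
  · -- split: `t_{P,V} = t_{π,v}` and the induced factors agree (`finprod_resolventSplit_eq`)
    rw [h1] at hPα
    simp only [pow_one, Multiset.map_id'] at hPα
    refine ⟨α, hPα, ?_⟩
    obtain ⟨W, hW⟩ := exists_above (E := L) V
    rw [hαθ]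
    exact (finprod_resolventSplit_eq hFL hKL hEL rfl hW h1 hvL hVu θ hθV).symm
  · -- inert: `t_{P,V} = t_{π,v}²` (`satakePolynomial_map_sq_eq_finprod_resolventInert`)
    rw [h2] at hPα
    exact ⟨_, hPα, satakePolynomial_map_sq_eq_finprod_resolventInert hG hFL hFK hKL hEL h3 rfl h2
      hvL hvE hvK hVu hEu θ hθV hαθ⟩

/-- **The archimedean components of the cubic induction, through the resolvent tower.**  In the
`S₃` sextic diagram (`K/F` the quadratic resolvent, `L = EK` the Galois closure, `L/K` cyclic
cubic, `L/E` quadratic), let `π` be a CUSPIDAL automorphic representation of `GL₃(𝔸_F)` with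
`det(X - t_{π,v}) = ∏_{w ∣ v} (X^{f(w|v)} - θ(ϖ_w))` almost everywhere (the unramified clause of
the fact), `τ` a realisation of `θ` on `GL₁(𝔸_E)` and `χ` its archimedean parameter.  Granting
* `baseChange_cyclic_cuspidal` (Arthur–Clozel Thm. 4.2 (a), datum model): `P = BC_{K/F}(π)`
  cuspidal — its non-twist hypothesis holds at an inert place by
  `exists_inert_hasSatakeParamAt_map_ne_of_resolvent`;
* `ArthurClozel1989_strongLifting_archimedean` (Thm. 5.1 with Ch. 1 §7), twice: the parameter
  of `π` restricts to that of `P` along `K/F`, and `χ` restricts to the parameter of the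
  realisation `τ_L` of `θ ∘ N_{L/E}` along `L/E` (rank one,
  `isWeakBaseChangeLiftAE_glOne_of_hasSatakeParamAt_baseChange`);
* `Henniart2012_infinityType_of_automorphicInduction` (Henniart 2012, Thm. 5): `P` is
  automorphically induced from `τ_L` along the cyclic cubic `L/K`
  (`eventually_hasSatakeParamAt_baseChange_of_resolvent`), so its parameter at `σ_K` is the sum
  of the parameters of `τ_L` at the `σ_L ∣ σ_K`;
* the existence of infinity types of cuspidal data (`AutomorphicRepData.exists_hasInfinityType`,
  Clozel 1990 §3.3, the currency of Henniart's fact),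
the parameter of `π` at `σ` is `∑_{σ_L ∣ σ_K} χ(σ_L|_E) = ∑_{σ' ∣ σ} χ(σ')`
(`sum_filter_comp_algebraMap_diamond`), by uniqueness of archimedean parameters
(Harish-Chandra, `AutomorphicRepData.hasArchParameter_unique`).
[cite: ArthurClozelAMS120, Ch. 3 Thm. 4.2 (a), Thm. 5.1 and Ch. 1 §7]
[cite: Henniart2012, §1.10, Thm. 3, Thm. 5 and Remarque §3.7] [cite: Clozel1990, §3.3] -/
theorem hasArchParameter_sum_of_resolvent
    (hBC : baseChange_cyclic_cuspidal) (hArch : ArthurClozel1989_strongLifting_archimedean)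
    (hHen : Henniart2012_infinityType_of_automorphicInduction)
    (hex : ∀ (n : ℕ) (M : Type) [Field M] [NumberField M] (hM : isCompact_glFiniteIntegralLevel n M)
      (Q : CuspidalAutomorphicRepData n M hM), Q.1.exists_hasInfinityType)
    [IsGalois F L] [IsGalois F K] (hG : ∃ g h : L ≃ₐ[F] L, g * h ≠ h * g)
    (hFK : Module.finrank F K = 2) (hKL : Module.finrank K L = 3) (hEL : Module.finrank E L = 2)
    (h3 : Module.finrank F E = 3) (θ : GaloisRepresentations.HeckeCharacter E)
    {hF : isCompact_glFiniteIntegralLevel 3 F} (π : CuspidalAutomorphicRepData 3 F hF)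
    (hπ : ∀ᶠ v : HeightOneSpectrum (𝓞 F) in cofinite, ∃ α : Multiset ℂ,
      π.1.HasSatakeParamAt v α ∧
        satakePolynomial α =
          ∏ᶠ w ∈ {w : HeightOneSpectrum (𝓞 E) | w.under (𝓞 F) = v},
            (X ^ w.asIdeal.inertiaDeg (𝓞 F) - C (θ.valueAtUniformizer w)))
    {hE : isCompact_glFiniteIntegralLevel 1 E} (τ : AutomorphicRepData (AutomorphyDatum.gl 1 E hE))
    (hτ : ∀ᶠ w : HeightOneSpectrum (𝓞 E) in cofinite, τ.HasSatakeParamAt w {θ.valueAtUniformizer w})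
    {χ : (E →+* ℂ) → Multiset ℂ} (hχ : τ.HasArchParameter χ) :
    π.1.HasArchParameter fun σ =>
      ∑ σ' ∈ Finset.univ.filter (fun σ' : E →+* ℂ => σ'.comp (algebraMap F E) = σ), χ σ' := by
  haveI : IsGalois K L := IsGalois.tower_top_of_isGalois F K L
  haveI : IsGalois E L := IsGalois.tower_top_of_isGalois F E L
  haveI : FiniteDimensional F L := Module.Finite.of_restrictScalars_finite ℚ F L
  haveI : FiniteDimensional F K := Module.Finite.of_restrictScalars_finite ℚ F K
  haveI : FiniteDimensional K L := Module.Finite.of_restrictScalars_finite ℚ K L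
  haveI : FiniteDimensional E L := Module.Finite.of_restrictScalars_finite ℚ E L
  have hFL : Module.finrank F L = 6 := by rw [← Module.finrank_mul_finrank F K L, hFK, hKL]
  have hp2 : (Module.finrank F K).Prime := hFK ▸ Nat.prime_two
  have hp2' : (Module.finrank E L).Prime := hEL ▸ Nat.prime_two
  have hp3 : (Module.finrank K L).Prime := hKL ▸ Nat.prime_three
  have hcycK : IsCyclic (K ≃ₐ[F] K) := isCyclic_algEquiv_of_finrank_prime hp2
  have hcycEL : IsCyclic (L ≃ₐ[E] L) := isCyclic_algEquiv_of_finrank_prime hp2'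
  have hcycL : IsCyclic (L ≃ₐ[K] L) := isCyclic_algEquiv_of_finrank_prime hp3
  set hK := isCompact_glFiniteIntegralLevel_holds 3 K
  set hL1 := isCompact_glFiniteIntegralLevel_holds 1 L
  -- `P = BC_{K/F}(π)`, cuspidal (Thm. 4.2 (a))
  obtain ⟨P, hPBC⟩ := hBC 3 F K hp2 hF π
    (exists_inert_hasSatakeParamAt_map_ne_of_resolvent hG hFL hFK hKL hEL h3 θ π.1 hπ) hK
  -- the realisation `τ_L` of `θ_L = θ ∘ N_{L/E}`; `P` is induced from `τ_L` along `L/K`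
  obtain ⟨τL, hτL⟩ :=
    exists_automorphicRepData_hasSatakeParamAt_valueAtUniformizer hL1 (θ.baseChange L)
  have hAI : IsAutomorphicInductionAlong τL P.1 :=
    (isAutomorphicInductionAlong_iff_of_hasSatakeParamAt_singleton (θ.baseChange L) hτL P.1).2
      (eventually_hasSatakeParamAt_baseChange_of_resolvent hG hFK hKL hEL h3 θ hπ hPBC)
  -- archimedean parameters: `χ_π` restricts to `P` (Thm. 5.1, `K/F`), `χ` to `τ_L` (`L/E`)
  obtain ⟨χπ, hχπ⟩ := π.1.exists_hasArchParameter_gl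
  have hPχ : P.1.HasArchParameter fun σK => χπ (σK.comp (algebraMap F K)) :=
    hArch 3 F K hF hK hcycK hp2 π P hPBC χπ hχπ
  have hτLχ : τL.HasArchParameter fun σL => χ (σL.comp (algebraMap E L)) :=
    hArch 1 E L hE hL1 hcycEL hp2' ⟨τ, τ.W_le_cuspFormsGL_one⟩ ⟨τL, τL.W_le_cuspFormsGL_one⟩
      (isWeakBaseChangeLiftAE_glOne_of_hasSatakeParamAt_baseChange θ hτ hτL) χ hχ
  -- Henniart's theorem on infinity types of `P` and `τ_L`
  obtain ⟨TP, hTP⟩ := hex 3 K hK P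
  obtain ⟨TL, hTL⟩ := hex 1 L hL1 ⟨τL, τL.W_le_cuspFormsGL_one⟩
  have hHen' := (Henniart2012_infinityType_of_automorphicInduction_iff_along.1 hHen) K L hcycL 1 3
    one_pos hKL hK hL1 P ⟨τL, τL.W_le_cuspFormsGL_one⟩ hAI TP TL hTP hTL
  have e1 : (fun σL : L →+* ℂ => (TL σL).map ArchWeight.a) =
      fun σL => χ (σL.comp (algebraMap E L)) := τL.hasArchParameter_unique hTL.2 hτLχ
  have e2 : (fun σK : K →+* ℂ => (TP σK).map ArchWeight.a) =
      fun σK => χπ (σK.comp (algebraMap F K)) := P.1.hasArchParameter_unique hTP.2 hPχ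
  -- conclusion
  have key : χπ = fun σ =>
      ∑ σ' ∈ Finset.univ.filter (fun σ' : E →+* ℂ => σ'.comp (algebraMap F E) = σ), χ σ' := by
    funext σ
    obtain ⟨σK, hσK⟩ : ∃ σK : K →+* ℂ, σK.comp (algebraMap F K) = σ :=
      ⟨ComplexEmbedding.lift K σ, ComplexEmbedding.lift_comp_algebraMap K σ⟩
    rw [← hσK, ← sum_filter_comp_algebraMap_diamond (F := F) hKL hEL h3 χ σK]
    have h2 : (TP σK).map ArchWeight.a = χπ (σK.comp (algebraMap F K)) := congr_fun e2 σK
    rw [← h2, hHen' σK]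
    exact Finset.sum_congr rfl fun σL _ => congr_fun e1 σL
  rw [← key]
  exact hχπ

end Resolvent

/-! ### The Galois (cyclic cubic) case: Henniart's theorem directly -/

section Galois

variable {F E : Type} [Field F] [NumberField F] [Field E] [NumberField E] [Algebra F E]

/-- **The archimedean components of the cubic induction, `E/F` Galois.**  For `E/F` Galois of
degree `3` (hence cyclic), a cuspidal `π` on `GL₃(𝔸_F)` with
`det(X - t_{π,v}) = ∏_{w ∣ v} (X^{f(w|v)} - θ(ϖ_w))` almost everywhere is automorphically induced
(Def. 6.1 a.e.) from every realisation `τ` of `θ` on `GL₁(𝔸_E)`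
(`isAutomorphicInductionAlong_iff_of_hasSatakeParamAt_singleton`), so Henniart's theorem
(`Henniart2012_infinityType_of_automorphicInduction`, Henniart 2012, Thm. 5, along `E/F` itself),
read on infinity types of `π` and `τ` (`AutomorphicRepData.exists_hasInfinityType`) and through
the uniqueness of archimedean parameters, gives `π` the parameter `σ ↦ ∑_{σ' ∣ σ} χ(σ')`.
[cite: Henniart2012, §1.10, Thm. 3, Thm. 5 and Remarque §3.7] [cite: Clozel1990, §3.3] -/
theorem hasArchParameter_sum_of_isGalois
    (hHen : Henniart2012_infinityType_of_automorphicInduction)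
    (hex : ∀ (n : ℕ) (M : Type) [Field M] [NumberField M] (hM : isCompact_glFiniteIntegralLevel n M)
      (Q : CuspidalAutomorphicRepData n M hM), Q.1.exists_hasInfinityType)
    [IsGalois F E] (h3 : Module.finrank F E = 3) (θ : GaloisRepresentations.HeckeCharacter E)
    {hF : isCompact_glFiniteIntegralLevel 3 F} (π : CuspidalAutomorphicRepData 3 F hF)
    (hπ : ∀ᶠ v : HeightOneSpectrum (𝓞 F) in cofinite, ∃ α : Multiset ℂ,
      π.1.HasSatakeParamAt v α ∧
        satakePolynomial α =
          ∏ᶠ w ∈ {w : HeightOneSpectrum (𝓞 E) | w.under (𝓞 F) = v},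
            (X ^ w.asIdeal.inertiaDeg (𝓞 F) - C (θ.valueAtUniformizer w)))
    {hE : isCompact_glFiniteIntegralLevel 1 E} (τ : AutomorphicRepData (AutomorphyDatum.gl 1 E hE))
    (hτ : ∀ᶠ w : HeightOneSpectrum (𝓞 E) in cofinite, τ.HasSatakeParamAt w {θ.valueAtUniformizer w})
    {χ : (E →+* ℂ) → Multiset ℂ} (hχ : τ.HasArchParameter χ) :
    π.1.HasArchParameter fun σ =>
      ∑ σ' ∈ Finset.univ.filter (fun σ' : E →+* ℂ => σ'.comp (algebraMap F E) = σ), χ σ' := by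
  haveI : FiniteDimensional F E := Module.Finite.of_restrictScalars_finite ℚ F E
  have hcyc : IsCyclic (E ≃ₐ[F] E) := isCyclic_algEquiv_of_finrank_prime (h3 ▸ Nat.prime_three)
  have hAI : IsAutomorphicInductionAlong τ π.1 :=
    (isAutomorphicInductionAlong_iff_of_hasSatakeParamAt_singleton θ hτ π.1).2 hπ
  obtain ⟨TP, hTP⟩ := hex 3 F hF π
  obtain ⟨Tτ, hTτ⟩ := hex 1 E hE ⟨τ, τ.W_le_cuspFormsGL_one⟩
  have hHen' := (Henniart2012_infinityType_of_automorphicInduction_iff_along.1 hHen) F E hcyc 1 3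
    one_pos h3 hF hE π ⟨τ, τ.W_le_cuspFormsGL_one⟩ hAI TP Tτ hTP hTτ
  have e1 : (fun σ' : E →+* ℂ => (Tτ σ').map ArchWeight.a) = χ := τ.hasArchParameter_unique hTτ.2 hχ
  have key : (fun σ : F →+* ℂ => (TP σ).map ArchWeight.a) = fun σ =>
      ∑ σ' ∈ Finset.univ.filter (fun σ' : E →+* ℂ => σ'.comp (algebraMap F E) = σ), χ σ' := by
    funext σ
    rw [hHen' σ]
    exact Finset.sum_congr rfl fun σ' _ => congr_fun e1 σ'
  rw [← key]
  exact hTP.2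

end Galois

/-! ### The fact from the sibling fact and the cyclic archimedean theory -/

/-- **`automorphicInduction_unitaryCharacter_cubic_archimedean` assembled from named facts of
the tree.**  The archimedean clause of the non-normal cubic induction of
Jacquet–Piatetski-Shapiro–Shalika is NOT an additional analytic input beyond the unramified
clause: granting
* the sibling fact `automorphicInduction_unitaryCharacter_cubic` (JPSS 1979, §§13–14; Gelbart
  1997, Thm. 5.3.1 with Remark 5.3.1 (e): the cuspidal `π` on `GL₃(𝔸_F)` with
  `det(X - t_{π,v}) = ∏_{w ∣ v} (X^{f(w|v)} - θ(ϖ_w))` a.e.),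
* `baseChange_cyclic_cuspidal` (Arthur–Clozel 1989, Ch. 3 Thm. 4.2 (a), datum model),
* `ArthurClozel1989_strongLifting_archimedean` (op. cit. Thm. 5.1 with Ch. 1 §7),
* `Henniart2012_infinityType_of_automorphicInduction` (Henniart 2012, Thm. 5), and
* the existence of infinity types of cuspidal automorphic representation data
  (`AutomorphicRepData.exists_hasInfinityType`, Clozel 1990, §3.3),
the fact holds.  For `E/F` Galois this is `hasArchParameter_sum_of_isGalois` (Henniart along
`E/F`); for `E/F` not normal, with `L` the Galois closure (`Gal(L/F) ≅ S₃`, the splitting field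
of the minimal polynomial of a primitive element, `finrank_splittingField_eq_six`,
`exists_mul_ne_of_not_normal`) and `K` the quadratic resolvent
(`exists_intermediateField_resolvent`), it is `hasArchParameter_sum_of_resolvent`: the
archimedean parameter of `π` is read off from `BC_{K/F}(π) = AI_{L/K}(θ ∘ N_{L/E})` — an
identity of unramified Hecke data in which the sign ambiguity of the descent direction (module
docstring of `AutomorphicInductionUnitaryCharacterCubicResolventDescent`) does not arise.
[cite: JPSS1981Cubique] [cite: JacquetPiatetskishapiroShalika1979II, §§13–14]
[cite: Gelbart1997, Thm. 5.3.1, Remark 5.3.1 (e) and §7.2 p. 258]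
[cite: ArthurClozelAMS120, Ch. 3 Thm. 4.2 (a), Thm. 5.1 and Ch. 1 §7]
[cite: Henniart2012, §1.10, Thm. 3, Thm. 5 and Remarque §3.7] [cite: Clozel1990, §3.3] -/
theorem automorphicInduction_unitaryCharacter_cubic_archimedean_of_cubic_of_cyclicArchimedean
    (hX : automorphicInduction_unitaryCharacter_cubic) (hBC : baseChange_cyclic_cuspidal)
    (hArch : ArthurClozel1989_strongLifting_archimedean)
    (hHen : Henniart2012_infinityType_of_automorphicInduction)
    (hex : ∀ (n : ℕ) (M : Type) [Field M] [NumberField M] (hM : isCompact_glFiniteIntegralLevel n M)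
      (Q : CuspidalAutomorphicRepData n M hM), Q.1.exists_hasInfinityType) :
    automorphicInduction_unitaryCharacter_cubic_archimedean := by
  intro F E _ _ _ _ _ h3 θ hθ hF hreg
  obtain ⟨π, hπ⟩ := hX.exists_cuspidal h3 θ hθ hreg hF
  refine ⟨π, hπ, fun hE τ hτ χ hχ => ?_⟩
  haveI : FiniteDimensional F E := Module.Finite.of_restrictScalars_finite ℚ F E
  by_cases hn : Normal F E
  · haveI := hn
    haveI : IsGalois F E := ⟨⟩
    exact hasArchParameter_sum_of_isGalois hHen hex h3 θ π hπ τ hτ hχ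
  · -- the Galois closure `L` of `E/F` (an `S₃`-sextic) and the quadratic resolvent `K`
    obtain ⟨α, hα⟩ := Field.exists_primitive_element F E
    obtain ⟨φ⟩ := nonempty_algHom_splittingField_of_adjoin_eq_top hα
    letI : Algebra E (minpoly F α).SplittingField := φ.toRingHom.toAlgebra
    haveI : IsScalarTower F E (minpoly F α).SplittingField :=
      IsScalarTower.of_algebraMap_eq fun x => (φ.commutes x).symm
    have hsep : (minpoly F α).Separable := Algebra.IsSeparable.isSeparable F α
    haveI : IsGalois F (minpoly F α).SplittingField := IsGalois.of_separable_splitting_field hsep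
    haveI : NumberField (minpoly F α).SplittingField :=
      NumberField.of_module_finite F (minpoly F α).SplittingField
    have h6 : Module.finrank F (minpoly F α).SplittingField = 6 :=
      finrank_splittingField_eq_six h3 hn hα
    have hG := exists_mul_ne_of_not_normal h3 hn hα
    have hEL : Module.finrank E (minpoly F α).SplittingField = 2 := by
      have := Module.finrank_mul_finrank F E (minpoly F α).SplittingField
      rw [h3, h6] at this
      omega
    obtain ⟨K, hFK, hKL, hKgal⟩ :=
      exists_intermediateField_resolvent (F := F) (L := (minpoly F α).SplittingField) h6
    haveI := hKgal
    exact hasArchParameter_sum_of_resolvent hBC hArch hHen hex hG hFK hKL hEL h3 θ π hπ τ hτ hχ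

end Literature.NumberTheory.Automorphic
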